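import Summits.NavierStokesRegularity.NavierStokesRegularity.Theorems.IsotropicBlobPressurePoisson
import Summits.NavierStokesRegularity.NavierStokesRegularity.Theorems.IsotropicBlobPressureHessian
import Summits.NavierStokesRegularity.NavierStokesRegularity.Theorems.IsotropicBlobWitnessFieldDeriv
import HarnessLib

/-!
# IsotropicBlobWitnessAssembly — the ROUND-41 `C²` SUB-PARITY WITNESS, assembled BY NAME modulo the field-side
# identities (S-door lane, LEAD ns-s30-p1 g4)

The pressure of record: `witnessPressure := zonalPressure Phi0 Phi2 Phi4` (profiles of nsreg-p1 g33's r41/glue1d_k4.txt,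
`IsotropicBlobPressureProfiles`, ns-s29-p2 g5).  This file proves, from the landed plates,

* `isDecayingPressureOf_witness_of`: the trace identity `−tr((∇u)²)(x) = Σ_l srcProfile_l(‖x‖²)·Z_l(x)` (ns-sfl-p1, V7)
  ⟹ `IsDecayingPressureOf witnessFieldC2 witnessPressure` (1-D Poisson identities `poisson_Phi_l_src`, decay bounds,
  plate W2 `isDecayingPressureOf_zonalPressure`);
* `strainFeed_witness_zero : strainFeed (fun _ => witnessFieldC2) (fun _ => witnessPressure) 0 0 e₃ = 9/14`
  (`curl u(0) = 0`, centre Hessian `2Φ₀′(0) + 4Φ₂(0) = −9/14`), `strainQuad … 0 0 e₃ = 1`;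
* `isStrainArgmax_witness_of`: the global strain bound `⟪∇u(y)e,e⟫ ≤ 1` for unit `e` (W3: p1's certificate
  `ArgmaxCover.strainFormC2_le_normSq` + sfl's identification) ⟹ `IsStrainArgmax (fun _ => witnessFieldC2) 0 0 e₃`;
* **`subParityWitnessOf_two_of`**: `C²` + divergence-free + trace identity + global strain bound ⟹
  `SubParityWitnessOf 2 (9/14)` (Sketch45 / `IsotropicBlobDefs`, VERBATIM), and `not_argmaxFeedParityOf_two_of`:
  the same ⟹ `¬ ArgmaxFeedParityOf 2` (τ1 at regularity 2 REFUTED) — both by `not_argmaxFeedParityOf_of_witness`.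

The four field-side inputs are discharged by name in `IsotropicBlobWitness.lean` once their files land.
`--supports stmt-NavierStokesRegularity-0056 --as helper`.
HONEST FRAME: a kinematic slice witness against τ1 (the hypothesis class of the S40/S41 clock doors); 0056 `NoTypeII`
/ 10661 / NS regularity NOT proved; no hard core touched.
-/

set_option linter.dupNamespace false

open Set Function Filter Topology InnerProductSpace
open scoped RealInnerProductSpace Laplacian ContDiff

namespace Summit.NavierStokesRegularity.NavierStokesRegularity.Theorems.StrainDoors

namespace IsotropicBlob

open HarmonicShell Literature.Analysis Literature.Analysis.FluidPDE VectorCalculus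
open Summit.NavierStokesRegularity.NavierStokesRegularity.Theorems.ArgmaxDoors

noncomputable section

/-- support (definition): THE PRESSURE OF THE `C²` WITNESS — the zonal pressure with the glued profiles
`Φ₀, Φ₂, Φ₄` of r41/glue1d_k4.txt (`p = Φ₀(‖x‖²) + Φ₂(‖x‖²)Z₂(x) + Φ₄(‖x‖²)Z₄(x)`). -/
def witnessPressure : EuclideanSpace ℝ (Fin 3) → ℝ := zonalPressure Phi0 Phi2 Phi4

/-- The witness pressure is `C²`. -/
theorem contDiff_witnessPressure : ContDiff ℝ 2 witnessPressure :=
  contDiff_two_zonalPressure contDiff_Phi0 contDiff_Phi2 contDiff_Phi4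

/-- The witness pressure decays at infinity. -/
theorem tendsto_witnessPressure_cocompact :
    Tendsto witnessPressure (cocompact (EuclideanSpace ℝ (Fin 3))) (𝓝 0) :=
  tendsto_zonalPressure_cocompact (fun _ hs => abs_Phi0_le_src hs) (fun _ hs => abs_Phi2_mul_le_src hs)
    (fun _ hs => abs_Phi4_mul_sq_le_src hs)

/-- The Laplacian of the witness pressure at every point: the glued zonal source. -/
theorem laplacian_witnessPressure (x : EuclideanSpace ℝ (Fin 3)) :
    Δ witnessPressure x =
      srcProfile0 (‖x‖ ^ 2) + srcProfile2 (‖x‖ ^ 2) * polyFun zonal2 x + srcProfile4 (‖x‖ ^ 2) * polyFun zonal4 x := by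
  rw [witnessPressure, laplacian_zonalPressure contDiff_Phi0 contDiff_Phi2 contDiff_Phi4 x, poisson_Phi0_src,
    poisson_Phi2_src, poisson_Phi4_src]

/-- **The witness pressure is THE DECAYING PRESSURE of `witnessFieldC2`**, given the trace identity (V7). -/
theorem isDecayingPressureOf_witness_of
    (hsrc : ∀ x : EuclideanSpace ℝ (Fin 3),
      -traceCLM ((fderiv ℝ witnessFieldC2 x).comp (fderiv ℝ witnessFieldC2 x)) =
        srcProfile0 (‖x‖ ^ 2) + srcProfile2 (‖x‖ ^ 2) * polyFun zonal2 x + srcProfile4 (‖x‖ ^ 2) * polyFun zonal4 x) :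
    IsDecayingPressureOf witnessFieldC2 witnessPressure :=
  isDecayingPressureOf_zonalPressure contDiff_Phi0 contDiff_Phi2 contDiff_Phi4 (fun s _ => poisson_Phi0_src s)
    (fun s _ => poisson_Phi2_src s) (fun s _ => poisson_Phi4_src s) hsrc (fun _ hs => abs_Phi0_le_src hs)
    (fun _ hs => abs_Phi2_mul_le_src hs) (fun _ hs => abs_Phi4_mul_sq_le_src hs)

/-- **The centre pressure Hessian along the axis**: `∇²p(0)(e₃,e₃) = −9/14`. -/
theorem pressureHess_witness_zero :
    pressureHess (fun _ => witnessPressure) 0 0 (EuclideanSpace.single 2 1) = -(9 / 14) := by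
  rw [show (fun _ : ℝ => witnessPressure) = fun _ => zonalPressure Phi0 Phi2 Phi4 from rfl,
    pressureHess_zonalPressure_zero_axis contDiff_Phi0 contDiff_Phi2 contDiff_Phi4, two_mul_deriv_Phi0_zero_add]

/-- **The centre strain feed of the witness**: `H(0,e₃) = 9/14` (no vorticity at the centre). -/
theorem strainFeed_witness_zero :
    strainFeed (fun _ => witnessFieldC2) (fun _ => witnessPressure) 0 0 (EuclideanSpace.single 2 1) = 9 / 14 := by
  rw [show (fun _ : ℝ => witnessPressure) = fun _ => zonalPressure Phi0 Phi2 Phi4 from rfl,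
    strainFeed_zonalPressure_zero_axis curl_witnessFieldC2_zero contDiff_Phi0 contDiff_Phi2 contDiff_Phi4,
    two_mul_deriv_Phi0_zero_add]
  norm_num

/-- The centre feed in witness form: `H = (9/14)·Λ²` with `Λ = 1`. -/
theorem strainFeed_witness_eq_mul :
    strainFeed (fun _ => witnessFieldC2) (fun _ => witnessPressure) 0 0 (EuclideanSpace.single 2 1) =
      9 / 14 * strainQuad (fun _ => witnessFieldC2) 0 0 (EuclideanSpace.single 2 1) ^ 2 := by
  rw [strainFeed_witness_zero, strainQuad_witnessFieldC2_zero]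
  norm_num

/-- **`(0, e₃)` is a GLOBAL strain argmax of the witness**, given the global strain bound
`⟪∇u(y)e,e⟫ ≤ 1` for unit `e` (W3 + the field-side identification). -/
theorem isStrainArgmax_witness_of
    (hstrain : ∀ y e : EuclideanSpace ℝ (Fin 3), ‖e‖ = 1 → ⟪fderiv ℝ witnessFieldC2 y e, e⟫ ≤ 1) :
    IsStrainArgmax (fun _ => witnessFieldC2) 0 0 (EuclideanSpace.single 2 1) := by
  refine ⟨by simp, fun y e' he' => ?_⟩
  rw [strainQuad_witnessFieldC2_zero]
  exact hstrain y e' he'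

/-- **THE `C²` SUB-PARITY WITNESS, modulo the field-side inputs**: `witnessFieldC2` `C²` and divergence-free,
the trace identity (source of the pressure Poisson equation) and the global strain bound ⟹ `SubParityWitnessOf 2 (9/14)`
(Sketch45's text, by name). -/
theorem subParityWitnessOf_two_of (hC2 : ContDiff ℝ 2 witnessFieldC2) (hdiv : IsDivFree witnessFieldC2)
    (hsrc : ∀ x : EuclideanSpace ℝ (Fin 3),
      -traceCLM ((fderiv ℝ witnessFieldC2 x).comp (fderiv ℝ witnessFieldC2 x)) =
        srcProfile0 (‖x‖ ^ 2) + srcProfile2 (‖x‖ ^ 2) * polyFun zonal2 x + srcProfile4 (‖x‖ ^ 2) * polyFun zonal4 x)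
    (hstrain : ∀ y e : EuclideanSpace ℝ (Fin 3), ‖e‖ = 1 → ⟪fderiv ℝ witnessFieldC2 y e, e⟫ ≤ 1) :
    SubParityWitnessOf 2 (9 / 14) := by
  refine ⟨witnessFieldC2, witnessPressure, 0, EuclideanSpace.single 2 1, hC2, hasCompactSupport_witnessFieldC2, hdiv,
    isDecayingPressureOf_witness_of hsrc, isStrainArgmax_witness_of hstrain, ?_, strainFeed_witness_eq_mul⟩
  rw [strainQuad_witnessFieldC2_zero]
  exact one_pos

/-- **τ1 at regularity 2 is FALSE, modulo the field-side inputs** (`not_argmaxFeedParityOf_of_witness`, `9/14 < 1`). -/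
theorem not_argmaxFeedParityOf_two_of (hC2 : ContDiff ℝ 2 witnessFieldC2) (hdiv : IsDivFree witnessFieldC2)
    (hsrc : ∀ x : EuclideanSpace ℝ (Fin 3),
      -traceCLM ((fderiv ℝ witnessFieldC2 x).comp (fderiv ℝ witnessFieldC2 x)) =
        srcProfile0 (‖x‖ ^ 2) + srcProfile2 (‖x‖ ^ 2) * polyFun zonal2 x + srcProfile4 (‖x‖ ^ 2) * polyFun zonal4 x)
    (hstrain : ∀ y e : EuclideanSpace ℝ (Fin 3), ‖e‖ = 1 → ⟪fderiv ℝ witnessFieldC2 y e, e⟫ ≤ 1) :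
    ¬ ArgmaxFeedParityOf 2 :=
  not_argmaxFeedParityOf_of_witness (by norm_num) (subParityWitnessOf_two_of hC2 hdiv hsrc hstrain)

end

end IsotropicBlob

end Summit.NavierStokesRegularity.NavierStokesRegularity.Theorems.StrainDoors
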